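import Literature.Probability.FitznerVanDerHofstad2017.NobleBoundingEvents
import Literature.Barriers.CriticalPhenomena.GaussianDominationRouteLaceExpansionPivotal
import HarnessLib

/-!
# [FvdH17] §4.4 (4.57)/(4.65), level `0`: the CODING of the first sausages INSIDE `C̃₀`, with the
# canonical choice `w₀ = 0` when `b̲₀ = 0`, PROVED

Source: R. Fitzner, R. van der Hofstad, *Mean-field behavior for nearest-neighbor percolation in
`d > 10`*, Electron. J. Probab. **22** (2017) no. 43 [FvdH17]; arXiv:1506.07977v2.

* (4.57) (arXiv v2 p. 41; EJP p. 38): "`F₀(b₀,w₀,z₁) = {0 ↔ b̲₀} ∘ {0 ↔ w₀} ∘ {w₀ ↔ b̲₀} ∘ {w₀ ↔ z₁}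
  ∩ {z₁ ∉ b₀}`", and §4.4 after (4.65) (v2 p. 43; TeX l.9113–9118): "we can choose `z_i` such that
  there exists a path from `w_{i-1}` to `z_i` in `C̃_{i-1}` that intersects `C̃_i` only at its endpoint
  `z_i` … all paths involved in the above connections are bond disjoint, even when they occur in
  different levels."
* [HvdH17] M. Heydenreich, R. van der Hofstad, *Progress in high-dimensional percolation and random
  graphs* (Springer 2017), (7.2.24) and (7.3.2) (the first sausages `{0 ⇔ u}` and the vertex `w`).

What this module proves (deterministic; the level-`0` companion of `NobleCodingLevelOne` /
`NobleLastSausageOffA`).  For a configuration `ω ⊆` bonds of `ℤ^d` in the level-`0` NoBLE cell —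
`{0 ⇔ y}` (`ω ∈ E'(0,y;ℤ^d)`), `y' ∉ C̃₀ := C̃^{(y,y')}(0)` (the non-backtracking condition of the cell)
— and `z ∈ C̃₀`:

* `notMem_edges_of_notMem_restrCluster` — no open `0`–`y` path uses the bond `(y,y')` (it would have
  to end with it, exposing `y' ∈ C̃₀`); hence (`reachable_restr_sdiff`) `{0 ⇔ y}` also holds in the
  RESTRICTED configuration `ω ∖ {(y,y')}`;
* `exists_laceCoding₀` — the CODING: a vertex `w` and four pairwise edge-disjoint walks
  `0 → y`, `0 → w`, `w → y`, `w → z`, all open in `ω ∖ {(y,y')}` — so every vertex and every bond of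
  them lies in `C̃₀` (`LaceCoding₀.mem_restrCluster_of_mem_support/edges`): exactly the membership the
  level-`1` off-`C̃₀` clause of `NobleCodingLevelOne` / `NobleLastSausageOffA` is matched against —
  WITH the canonical choice `y = 0 → w = 0` (the typed block tables vanish on `b̲₀ = 0 ∧ w₀ ≠ 0`;
  HOME/DIVERGENCE D74 (ii));
* `LaceCoding₀.mem_eventF0` — in particular `ω ∈ F₀((y,y'),w,z)` ((4.57)) when `z ≠ y`.

Nothing here is a cited hypothesis; everything is kernel-proved for arbitrary `ω`.

## References
* [FvdH17] arXiv:1506.07977v2 (4.57) p. 41, §4.4 p. 43 (after (4.65)); EJP 22 (2017) no. 43 pp. 38, 40–41.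
* [HvdH17] (7.2.24), (7.3.2).
-/

namespace Literature.Probability.FitznerVanDerHofstad2017

open Literature.Barriers.CriticalPhenomena Literature.Probability.Percolation
open Literature.Probability.LatticeModels Literature.Combinatorics.SimpleGraph _root_.SimpleGraph

variable {d : ℕ}

/-! ### A. No open `0`–`y` path uses the bond `(y, y')` when `y' ∉ C̃^{(y,y')}(0)` -/

/-- If `y' ∉ C̃^{(y,y')}(0)`, an open `0`–`y` PATH does not use the bond `(y,y')`: the bond would be
its last edge, traversed from `y'`, and the initial piece would join `0` to `y'` without it.
[cite: FitznerVanDerHofstad2017, (3.25)–(3.27) (arXiv:1506.07977v2 pp. 25–27): the cell's condition `b̄ ∉ C̃^{b}`] -/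
theorem notMem_edges_of_notMem_restrCluster {ω : BondConfig (Site d)} {y y' : Site d}
    (hy' : y' ∉ restrCluster y y' 0 ω) (p : (openGraph ω).Walk 0 y) (hp : p.IsPath) :
    s(y, y') ∉ p.edges := by
  intro he
  have hne : y ≠ y' := (p.adj_of_mem_edges he).ne
  obtain ⟨q, r, hqr⟩ := Walk.mem_support_iff_exists_append.1 (p.snd_mem_support_of_mem_edges he)
  have hq : s(y, y') ∉ q.edges := by
    intro heq
    rw [hqr] at hp
    obtain ⟨-, -, hmeet⟩ := LaceGraph.isPath_of_append hp
    exact hne (hmeet y (q.fst_mem_support_of_mem_edges heq) r.end_mem_support)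
  exact hy' ((mem_restrCluster_iff y y' 0 y' ω).2 (reachable_sdiff_of_walk q hq))

/-- `C̃^{(y,y')}(0)` only shrinks when a bond is closed. [folklore] -/
theorem restrCluster_sdiff_subset (ω : BondConfig (Site d)) (y y' : Site d) (e : Sym2 (Site d)) :
    restrCluster y y' 0 (ω \ {e}) ⊆ restrCluster y y' 0 ω := fun x hx => by
  rw [mem_restrCluster_iff] at hx ⊢
  exact hx.mono (openGraph_mono fun _ h => ⟨h.1.1, h.2⟩)

/-- **`{0 ⇔ y}` survives the restriction.** In the level-`0` cell (`ω ∈ E'(0,y;ℤ^d)`, `y' ∉ C̃₀`), for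
every bond `e` the vertices `0` and `y` are joined in `(ω ∖ {(y,y')}) ∖ {e}`: no bond is pivotal for
`0 → y` (the `E'` clause), and the resulting paths avoid `(y,y')`.
[cite: HeydenreichVanDerHofstad2017, (7.2.24)] [cite: FitznerVanDerHofstad2017, (4.57), (4.65) (arXiv:1506.07977v2 pp. 41, 43)] -/
theorem reachable_restr_sdiff {ω : BondConfig (Site d)} (hω : ω ⊆ (zdGraph d).edgeSet) {y y' : Site d}
    (hE : ω ∈ laceE Set.univ 0 y) (hy' : y' ∉ restrCluster y y' 0 ω) (e : Sym2 (Site d)) :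
    (openGraph ((ω \ {s(y, y')}) \ {e})).Reachable 0 y := by
  classical
  obtain ⟨hconn, hpiv⟩ := (mem_laceE_iff Set.univ 0 y ω).1 hE
  rw [connThrough_univ] at hconn
  obtain ⟨p, hp⟩ := (show (openGraph ω).Reachable 0 y from hconn).exists_isPath
  -- no bond is pivotal for `0 → y`
  have key : (openGraph (ω \ {e})).Reachable 0 y := by
    by_cases he : e ∈ p.edges
    · by_contra h0y
      obtain ⟨a, b, q₁, hab, q₂, rfl, hq⟩ := LaceGraph.exists_append_cons_of_mem_edges p he
      have hP := isPivotalBond_of_not_reachable hω q₁ hab q₂ (hq ▸ hp) h0y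
      have h0a : ω ∉ connThrough Set.univ 0 a := hpiv a b hP
      rw [connThrough_univ] at h0a
      exact h0a ⟨q₁⟩
    · exact reachable_sdiff_of_walk p he
  -- an open `0–y` path of `ω ∖ {e}` avoids `(y, y')`
  obtain ⟨pe, hpe⟩ := key.exists_isPath
  have hy'e : y' ∉ restrCluster y y' 0 (ω \ {e}) := fun h => hy' (restrCluster_sdiff_subset ω y y' e h)
  have havoid := notMem_edges_of_notMem_restrCluster hy'e pe hpe
  rw [Set.sdiff_sdiff_comm]
  exact reachable_sdiff_of_walk pe havoid

/-! ### B. The coding of level `0` -/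

/-- The CODING of a level-`0` configuration: four pairwise edge-disjoint walks
`0 → y`, `0 → w`, `w → y`, `w → z`, open in the restricted configuration `ω ∖ {(y,y')}` (so inside
`C̃^{(y,y')}(0)`), with the canonical choice `y = 0 → w = 0`.
[cite: FitznerVanDerHofstad2017, (4.57) and §4.4 after (4.65) (arXiv:1506.07977v2 pp. 41, 43)] -/
structure LaceCoding₀ (ω : BondConfig (Site d)) (y y' w z : Site d) where
  /-- `{0 ↔ b̲₀}` -/
  W₁ : (openGraph (ω \ {s(y, y')})).Walk 0 y
  /-- `{0 ↔ w₀}` -/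
  W₂ : (openGraph (ω \ {s(y, y')})).Walk 0 w
  /-- `{w₀ ↔ b̲₀}` -/
  W₃ : (openGraph (ω \ {s(y, y')})).Walk w y
  /-- `{w₀ ↔ z₁}` -/
  W₄ : (openGraph (ω \ {s(y, y')})).Walk w z
  d₁₂ : List.Disjoint W₁.edges W₂.edges
  d₁₃ : List.Disjoint W₁.edges W₃.edges
  d₁₄ : List.Disjoint W₁.edges W₄.edges
  d₂₃ : List.Disjoint W₂.edges W₃.edges
  d₂₄ : List.Disjoint W₂.edges W₄.edges
  d₃₄ : List.Disjoint W₃.edges W₄.edges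
  /-- the canonical choice "when `b̲₀ = 0` take `w₀ = 0`" -/
  canon : y = 0 → w = 0

namespace LaceCoding₀

variable {ω : BondConfig (Site d)} {y y' w z : Site d}

/-- Every vertex of an open walk of `ω ∖ {(y,y')}` starting in `C̃^{(y,y')}(0)` lies in `C̃^{(y,y')}(0)`. [folklore] -/
theorem mem_restrCluster_of_walk {a c : Site d} (W : (openGraph (ω \ {s(y, y')})).Walk a c)
    (ha : a ∈ restrCluster y y' 0 ω) : ∀ x ∈ W.support, x ∈ restrCluster y y' 0 ω := by
  intro x hx
  obtain ⟨q, -, -⟩ := Walk.mem_support_iff_exists_append.1 hx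
  rw [mem_restrCluster_iff] at ha ⊢
  exact ha.trans ⟨q⟩

/-- `0 ∈ C̃^{(y,y')}(0)`. [folklore] -/
theorem zero_mem_restrCluster (ω : BondConfig (Site d)) (y y' : Site d) : (0 : Site d) ∈ restrCluster y y' 0 ω :=
  (mem_restrCluster_iff y y' 0 0 ω).2 (Reachable.refl _)

/-- `w ∈ C̃₀`. [cite: FitznerVanDerHofstad2017, §4.4 after (4.65) (arXiv:1506.07977v2 p. 43)] -/
theorem w_mem (c : LaceCoding₀ ω y y' w z) : w ∈ restrCluster y y' 0 ω :=
  mem_restrCluster_of_walk c.W₂ (zero_mem_restrCluster ω y y') w c.W₂.end_mem_support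

/-- **All four coded connections live inside `C̃₀`** (vertices).
[cite: FitznerVanDerHofstad2017, §4.4 after (4.65) (arXiv:1506.07977v2 p. 43)] -/
theorem mem_restrCluster_of_mem_support (c : LaceCoding₀ ω y y' w z) (x : Site d)
    (hx : x ∈ c.W₁.support ∨ x ∈ c.W₂.support ∨ x ∈ c.W₃.support ∨ x ∈ c.W₄.support) :
    x ∈ restrCluster y y' 0 ω := by
  rcases hx with hx | hx | hx | hx
  · exact mem_restrCluster_of_walk c.W₁ (zero_mem_restrCluster ω y y') x hx
  · exact mem_restrCluster_of_walk c.W₂ (zero_mem_restrCluster ω y y') x hx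
  · exact mem_restrCluster_of_walk c.W₃ c.w_mem x hx
  · exact mem_restrCluster_of_walk c.W₄ c.w_mem x hx

/-- **All four coded connections live inside `C̃₀`** (bonds: both endpoints of every bond used).
This is the membership the level-`1` off-`C̃₀` clause is matched against
(`NobleCodingLevelOne.LaceCoding.disjoint_of_forall_mem`).
[cite: FitznerVanDerHofstad2017, §4.4 after (4.65) (arXiv:1506.07977v2 p. 43)] -/
theorem mem_restrCluster_of_mem_edges (c : LaceCoding₀ ω y y' w z) (e : Sym2 (Site d))
    (he : e ∈ c.W₁.edges ∨ e ∈ c.W₂.edges ∨ e ∈ c.W₃.edges ∨ e ∈ c.W₄.edges) :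
    ∀ x ∈ e, x ∈ restrCluster y y' 0 ω := by
  have key : ∀ {a b : Site d} (W : (openGraph (ω \ {s(y, y')})).Walk a b),
      (∀ x ∈ W.support, x ∈ restrCluster y y' 0 ω) →
      ∀ e ∈ W.edges, ∀ x ∈ e, x ∈ restrCluster y y' 0 ω := by
    intro a b W hW e he
    induction e using Sym2.ind with
    | h x₁ x₂ =>
      intro x hx
      rcases Sym2.mem_iff.1 hx with rfl | rfl
      · exact hW _ (W.fst_mem_support_of_mem_edges he)
      · exact hW _ (W.snd_mem_support_of_mem_edges he)
  rcases he with he | he | he | he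
  · exact key c.W₁ (fun x hx => c.mem_restrCluster_of_mem_support x (Or.inl hx)) e he
  · exact key c.W₂ (fun x hx => c.mem_restrCluster_of_mem_support x (Or.inr (Or.inl hx))) e he
  · exact key c.W₃ (fun x hx => c.mem_restrCluster_of_mem_support x (Or.inr (Or.inr (Or.inl hx)))) e he
  · exact key c.W₄ (fun x hx => c.mem_restrCluster_of_mem_support x (Or.inr (Or.inr (Or.inr hx)))) e he

/-- `z ∈ C̃₀` (recorded) and, when `y' ∉ C̃₀`, `w ≠ y'` and `z ≠ y'`.
[cite: FitznerVanDerHofstad2017, (4.57) clause `z₁ ∉ b₀` (arXiv:1506.07977v2 p. 41)] -/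
theorem ne_of_notMem (c : LaceCoding₀ ω y y' w z) (hy' : y' ∉ restrCluster y y' 0 ω) : w ≠ y' ∧ z ≠ y' :=
  ⟨fun h => hy' (h ▸ c.w_mem),
   fun h => hy' (h ▸ mem_restrCluster_of_walk c.W₄ c.w_mem z c.W₄.end_mem_support)⟩

/-- The four coded connections occur disjointly in the restricted configuration `ω ∖ {(y,y')}`.
[cite: FitznerVanDerHofstad2017, (4.57) (arXiv:1506.07977v2 p. 41)] -/
theorem sdiff_mem_disjointOccurrenceList (c : LaceCoding₀ ω y y' w z) :
    ω \ {s(y, y')} ∈ disjointOccurrenceList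
      [openConn 0 y, openConn 0 w, openConn w y, (openConn w z : Set (BondConfig (Site d)))] :=
  mem_disjointOccurrenceList_of_walks c.W₁ c.W₂ c.W₃ c.W₄ c.d₁₂ c.d₁₃ c.d₁₄ c.d₂₃ c.d₂₄ c.d₃₄

/-- … hence in `ω` itself (the events are increasing). [cite: FitznerVanDerHofstad2017, (4.57) (arXiv:1506.07977v2 p. 41)] -/
theorem mem_disjointOccurrenceList (c : LaceCoding₀ ω y y' w z) :
    ω ∈ disjointOccurrenceList
      [openConn 0 y, openConn 0 w, openConn w y, (openConn w z : Set (BondConfig (Site d)))] :=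
  isUpperSet_disjointOccurrenceList
    (fun A hA => by
      simp only [List.mem_cons, List.not_mem_nil, or_false] at hA
      rcases hA with rfl | rfl | rfl | rfl <;> exact isUpperSet_openConn _ _)
    Set.sdiff_subset c.sdiff_mem_disjointOccurrenceList

/-- **`F₀((y,y'),w,z)` occurs** ((4.57)) as soon as `z ≠ y` (given `y' ∉ C̃₀`).
[cite: FitznerVanDerHofstad2017, (4.57) and (4.65) (arXiv:1506.07977v2 pp. 41, 43)] -/
theorem mem_eventF0 (c : LaceCoding₀ ω y y' w z) (hy' : y' ∉ restrCluster y y' 0 ω) (hzy : z ≠ y) :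
    ω ∈ eventF0 y y' w z := by
  refine ⟨c.mem_disjointOccurrenceList, ?_⟩
  simp only [Set.mem_setOf_eq, Sym2.mem_iff, not_or]
  exact ⟨hzy, (c.ne_of_notMem hy').2⟩

end LaceCoding₀

/-- **The coding lemma of level `0`.** For a configuration using bonds of `ℤ^d` in the level-`0` cell
(`{0 ⇔ y}` and `y' ∉ C̃^{(y,y')}(0)`) and `z ∈ C̃^{(y,y')}(0)`, there are `w` and four pairwise
edge-disjoint walks `0 → y`, `0 → w`, `w → y`, `w → z` open in `ω ∖ {(y,y')}`, with `w = 0` whenever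
`y = 0`.  (`w` = the last vertex of an open `0`–`z` path of `C̃₀` on two edge-disjoint open `0`–`y`
paths of `C̃₀` — Menger, as no bond is pivotal for `0 → y` and none of these paths uses `(y,y')`.)
[cite: FitznerVanDerHofstad2017, (4.57), (4.65) and §4.4 after (4.65) (arXiv:1506.07977v2 pp. 41, 43; EJP 22 (2017) no. 43 pp. 38, 40–41)] [cite: HeydenreichVanDerHofstad2017, (7.2.24) and (7.3.2)] -/
theorem exists_laceCoding₀ {ω : BondConfig (Site d)} (hω : ω ⊆ (zdGraph d).edgeSet) {y y' z : Site d}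
    (hE : ω ∈ laceE Set.univ 0 y) (hy' : y' ∉ restrCluster y y' 0 ω) (hz : z ∈ restrCluster y y' 0 ω) :
    ∃ w : Site d, Nonempty (LaceCoding₀ ω y y' w z) := by
  classical
  rw [mem_restrCluster_iff] at hz
  obtain ⟨S⟩ := hz
  by_cases hy0 : y = 0
  · subst hy0
    exact ⟨0, ⟨⟨Walk.nil, Walk.nil, Walk.nil, S, by simp, by simp, by simp, by simp, by simp, by simp,
      fun _ => rfl⟩⟩⟩
  · have hreach := reachable_restr_sdiff hω hE hy'
    obtain ⟨p, hp⟩ :=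
      ((hreach s(y, y)).mono (openGraph_mono fun _ h => h.1)).exists_isPath
    obtain ⟨P, Q, hP, hQ, hPQ⟩ := LaceGraph.exists_two_edgeDisjoint_paths p.reverse hp.reverse
      fun e _ => exists_walk_of_reachable_sdiff (hreach e)
    obtain ⟨w, W₁, W₂, W₃, W₄, h12, h13, h14, h23, h24, h34⟩ :=
      LaceGraph.exists_theta P Q hP hQ hPQ S
    exact ⟨w, ⟨⟨W₃, W₁, W₂, W₄, h13.symm, h23.symm, h34, h12, h14, h24, fun h => absurd h hy0⟩⟩⟩

/-- The same for the cell as typed (`laceE {0} 0 y`, the level-`0` cell of `Ξ = Ξ^{∅}(0,·;{0})`).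
[cite: FitznerVanDerHofstad2017, (3.43) and (4.65) (arXiv:1506.07977v2 pp. 28, 43)] -/
theorem exists_laceCoding₀' {ω : BondConfig (Site d)} (hω : ω ⊆ (zdGraph d).edgeSet) {y y' z : Site d}
    (hE : ω ∈ laceE {0} 0 y) (hy' : y' ∉ restrCluster y y' 0 ω) (hz : z ∈ restrCluster y y' 0 ω) :
    ∃ w : Site d, Nonempty (LaceCoding₀ ω y y' w z) := by
  rw [laceE_singleton_start_eq_univ] at hE
  exact exists_laceCoding₀ hω hE hy' hz

/-- Corollary in the shape of the tree's `exists_mem_eventF0`, with the canonical `w`: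
`{0 ⇔ y} ∩ {y' ∉ C̃₀} ∩ {z ∈ C̃₀} ⊆ ⋃_{w : y = 0 → w = 0} F₀((y,y'),w,z)` for `z ≠ y`.
[cite: FitznerVanDerHofstad2017, (4.57) and (4.65) (arXiv:1506.07977v2 pp. 41, 43)] -/
theorem exists_mem_eventF0_canonical {ω : BondConfig (Site d)} (hω : ω ⊆ (zdGraph d).edgeSet)
    {y y' z : Site d} (hE : ω ∈ laceE {0} 0 y) (hz : z ∈ restrCluster y y' 0 ω)
    (hy' : y' ∉ restrCluster y y' 0 ω) (hzy : z ≠ y) :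
    ∃ w : Site d, (y = 0 → w = 0) ∧ ω ∈ eventF0 y y' w z := by
  obtain ⟨w, ⟨c⟩⟩ := exists_laceCoding₀' hω hE hy' hz
  exact ⟨w, c.canon, c.mem_eventF0 hy' hzy⟩

end Literature.Probability.FitznerVanDerHofstad2017
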